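import Mathlib.LinearAlgebra.Matrix.Adjugate
import Mathlib.Data.Matrix.Basic
import Mathlib.Tactic
import HarnessLib

/-!
# The SHARP adjugate letter of a TRIANGULAR reduced saturated basis: `|C j k| ≤ 2^{n−1}·N` (Hessenberg minors)

Support file (theorems only; no definitions, no named facts).  Cell `abc-stewartyu` (HOME `run/shared/lean/pub/abc-stewartyu/`), route
`YuMatveevShapeRat` (rung A1.L), crux r2 `ArchCoreRat` (stmt-ABC-20502), seat p2 (g8) — repair (R-d′) of the n-uniformity defect found by
p1 g11 (STATUS 2026-08-27T21:45:31Z) in the closed letter lines: the coordinate matrix `C` of a saturated frame (`C·U = N·1 = U·C`,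
`|det C| = N`, reduced basis `0 ≤ Uᵢⱼ ≤ N`) was bounded by `|C j k| ≤ (n−1)!·N` (`SatBasisReduced.abs_le_of_mul_eq_smul_one`: Cramer +
`Matrix.det_le` on an arbitrary `(n−1)`-minor), and `log (n−1)!` multiplied by the top order `T₀ ≍ nL` is not paid by the `n`-uniform budget.
On the TRIANGULAR reduced basis of the r2 frame (the shape letter `k < j → U k j = 0` of `ArchG3Line.LinesSupplyS`) every `(n−1)`-minor of
`U` is a HESSENBERG matrix (one sub-diagonal), whose determinant expands along the first column into TWO terms; hence
`|minor| ≤ (2N)^{n−1}` and **`|C j k| ≤ 2^{n−1}·N`** (the true maximum over all such frames is the Fibonacci number `F_{n−1}·N`,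
cell kit `work/kit/adjbound.py`).  No letter of the registered START/LINES texts changes: the bound is a theorem about them.

* `abs_det_le_of_upperHessenberg` — `M a b = 0` for `b + 1 < a`, `0 ≤ M ≤ N` ⇒ `|det M| ≤ (2N)^m`;
* `upperHessenberg_submatrix_of_upperTriangular` — minors `U.submatrix k.succAbove j.succAbove` of an upper-triangular `U` are upper Hessenberg;
* **`abs_le_two_pow_of_mul_eq_smul_one_upper`** / **`…_lower`** — `|C j k| ≤ 2^{n−1}·N` for upper- resp. lower-triangular reduced `U`.

## References
* [Cassels1997] J. W. S. Cassels, *An Introduction to the Geometry of Numbers*, Ch. I §2.2 (triangular bases of a lattice).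
* [Nesterenko2003] Yu. V. Nesterenko, LNM 1819 (2003) — §3.4–3.5 (the lattice `𝔑` and its basis; the size of the coordinates).
* Li Ching, *The maximum determinant of an n×n lower Hessenberg (0,1) matrix*, Linear Algebra Appl. 183 (1993) 147–153 (sharp constant; not used).
-/

namespace Summit.ABC.StewartYu

namespace SatBasisReduced

open Finset Matrix
open scoped Nat

/-! ### `Fin.succAbove` bookkeeping -/

/-- `i ≤ p.succAbove i ≤ i + 1` on values. [folklore] -/
theorem val_succAbove_bounds {m : ℕ} (p : Fin (m + 1)) (i : Fin m) :
    (i : ℕ) ≤ (p.succAbove i : ℕ) ∧ (p.succAbove i : ℕ) ≤ i + 1 := by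
  unfold Fin.succAbove
  split_ifs <;> simp

/-- for `p ≤ i` (on values) `p.succAbove i = i.succ`. [folklore] -/
theorem succAbove_eq_succ_of_val_le {m : ℕ} (p : Fin (m + 1)) (i : Fin m) (h : (p : ℕ) ≤ i) :
    p.succAbove i = i.succ :=
  Fin.succAbove_of_le_castSucc _ _ (by rw [Fin.le_iff_val_le_val]; simpa using h)

/-! ### Hessenberg determinants -/

/-- **Determinant of a boxed upper-Hessenberg integer matrix**: if `M a b = 0` whenever `b + 1 < a` and `0 ≤ M a b ≤ N`, then
`|det M| ≤ (2N)^m` (Laplace along the first column has two non-zero terms). [folklore] -/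
theorem abs_det_le_of_upperHessenberg : ∀ (m : ℕ) (M : Matrix (Fin m) (Fin m) ℤ) (N : ℕ),
    (∀ a b : Fin m, (b : ℕ) + 1 < a → M a b = 0) → (∀ a b, 0 ≤ M a b ∧ M a b ≤ N) →
    |M.det| ≤ (2 * (N : ℤ)) ^ m
  | 0, M, N, _, _ => by simp [Matrix.det_fin_zero]
  | m + 1, M, N, hH, hbox => by
    -- the minors along the first column at rows `p ≤ 1` are Hessenberg again
    have hsub : ∀ p : Fin (m + 1), (p : ℕ) ≤ 1 →
        |(M.submatrix p.succAbove Fin.succ).det| ≤ (2 * (N : ℤ)) ^ m := by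
      intro p hp
      refine abs_det_le_of_upperHessenberg m _ N (fun a b hab => ?_) (fun a b => hbox _ _)
      rw [Matrix.submatrix_apply, succAbove_eq_succ_of_val_le p a (by omega)]
      exact hH _ _ (by simp; omega)
    have hterm : ∀ p : Fin (m + 1), (p : ℕ) ≤ 1 →
        |(-1 : ℤ) ^ (p : ℕ) * M p 0 * (M.submatrix p.succAbove Fin.succ).det| ≤ N * (2 * (N : ℤ)) ^ m := by
      intro p hp
      rw [abs_mul, abs_mul, abs_pow, abs_neg, abs_one, one_pow, one_mul, abs_of_nonneg (hbox p 0).1]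
      exact mul_le_mul (hbox p 0).2 (hsub p hp) (abs_nonneg _) (by positivity)
    rw [Matrix.det_succ_column_zero, Fin.sum_univ_succ]
    cases m with
    | zero =>
      -- `1 × 1`
      simp only [Finset.univ_eq_empty, Finset.sum_empty, add_zero]
      have h0 := hterm 0 (by simp)
      have hN : (0 : ℤ) ≤ N := by positivity
      calc |(-1 : ℤ) ^ ((0 : Fin 1) : ℕ) * M 0 0 * (M.submatrix (0 : Fin 1).succAbove Fin.succ).det|
          ≤ N * (2 * (N : ℤ)) ^ 0 := h0
        _ ≤ (2 * (N : ℤ)) ^ (0 + 1) := by rw [pow_zero, mul_one, zero_add, pow_one]; linarith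
    | succ m =>
      rw [Fin.sum_univ_succ]
      -- the rows `≥ 2` of the first column vanish
      have htail : ∑ i : Fin m, (-1 : ℤ) ^ ((i.succ.succ : Fin (m + 2)) : ℕ) * M i.succ.succ 0 *
          (M.submatrix (i.succ.succ).succAbove Fin.succ).det = 0 := by
        refine Finset.sum_eq_zero fun i _ => ?_
        rw [hH i.succ.succ 0 (by simp), mul_zero, zero_mul]
      rw [htail, add_zero]
      have h0 := hterm 0 (by simp)
      have h1 := hterm 1 (by simp)
      have hN : (0 : ℤ) ≤ N := by positivity
      calc |(-1 : ℤ) ^ ((0 : Fin (m + 2)) : ℕ) * M 0 0 * (M.submatrix (0 : Fin (m + 2)).succAbove Fin.succ).det +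
            (-1 : ℤ) ^ (((0 : Fin (m + 1)).succ : Fin (m + 2)) : ℕ) * M (0 : Fin (m + 1)).succ 0 *
              (M.submatrix ((0 : Fin (m + 1)).succ).succAbove Fin.succ).det|
          ≤ N * (2 * (N : ℤ)) ^ (m + 1) + N * (2 * (N : ℤ)) ^ (m + 1) := (abs_add_le _ _).trans (add_le_add h0 h1)
        _ = (2 * (N : ℤ)) ^ (m + 1 + 1) := by ring

/-- **Minors of an upper-triangular matrix are upper Hessenberg**: if `U a b = 0` for `b < a` then
`(U.submatrix k.succAbove j.succAbove) a b = 0` for `b + 1 < a`. [folklore] -/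
theorem upperHessenberg_submatrix_of_upperTriangular {m : ℕ} (U : Matrix (Fin (m + 1)) (Fin (m + 1)) ℤ)
    (htri : ∀ a b : Fin (m + 1), (b : ℕ) < a → U a b = 0) (k j : Fin (m + 1)) :
    ∀ a b : Fin m, (b : ℕ) + 1 < a → (U.submatrix k.succAbove j.succAbove) a b = 0 := by
  intro a b hab
  rw [Matrix.submatrix_apply]
  have ha := (val_succAbove_bounds k a).1
  have hb := (val_succAbove_bounds j b).2
  exact htri _ _ (by omega)

/-! ### The sharp coordinate letter -/

/-- **Entries of `C` on an UPPER-TRIANGULAR reduced basis**: `C·U = N·1`, `|det C| = N`, `0 ≤ Uᵢⱼ ≤ N`, `U a b = 0` for `b < a`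
⇒ `|C j k| ≤ 2^{n−1}·N` (Cramer: `det U·C = N·adj U`, `|det U| = N^{n−1}`, Hessenberg minors `≤ (2N)^{n−1}`).
[cite: Cassels1997, Ch. I §2.2 Thm I; shape only] -/
theorem abs_le_two_pow_of_mul_eq_smul_one_upper {n : ℕ} {N : ℕ} (hN : 0 < N) (C U : Matrix (Fin n) (Fin n) ℤ)
    (hCU : C * U = (N : ℤ) • (1 : Matrix (Fin n) (Fin n) ℤ)) (hdet : |C.det| = N)
    (hbox : ∀ i j, 0 ≤ U i j ∧ U i j ≤ N) (htri : ∀ a b : Fin n, (b : ℕ) < a → U a b = 0) (j k : Fin n) :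
    |C j k| ≤ 2 ^ (n - 1) * (N : ℤ) := by
  cases n with
  | zero => exact Fin.elim0 j
  | succ m =>
    have hNz : (N : ℤ) ≠ 0 := by exact_mod_cast hN.ne'
    have hdd : C.det * U.det = (N : ℤ) ^ (m + 1) := by
      rw [← Matrix.det_mul, hCU, Matrix.det_smul, Matrix.det_one, mul_one, Fintype.card_fin]
    have hdU : |U.det| = (N : ℤ) ^ m := by
      have h := congrArg abs hdd
      rw [abs_mul, hdet, abs_pow, Nat.abs_cast, pow_succ'] at h
      exact mul_left_cancel₀ hNz h
    have hadj : U.det * C j k = N * U.adjugate j k := by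
      have h : C * U * U.adjugate = ((N : ℤ) • (1 : Matrix (Fin (m + 1)) (Fin (m + 1)) ℤ)) * U.adjugate := by
        rw [hCU]
      rw [Matrix.mul_assoc, Matrix.mul_adjugate, Matrix.mul_smul, Matrix.mul_one, Matrix.smul_mul,
        Matrix.one_mul] at h
      have := congrFun (congrFun h j) k
      simpa [Matrix.smul_apply, mul_comm] using this
    -- the Hessenberg minor
    have h1 : |U.adjugate j k| ≤ (2 * (N : ℤ)) ^ m := by
      rw [Matrix.adjugate_fin_succ_eq_det_submatrix, abs_mul, abs_pow, abs_neg, abs_one, one_pow, one_mul]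
      exact abs_det_le_of_upperHessenberg m _ N (upperHessenberg_submatrix_of_upperTriangular U htri k j)
        (fun a b => hbox _ _)
    have h2 : |U.det| * |C j k| ≤ (N : ℤ) * (2 * (N : ℤ)) ^ m := by
      rw [← abs_mul, hadj, abs_mul, Nat.abs_cast]
      exact mul_le_mul_of_nonneg_left h1 (by positivity)
    rw [hdU] at h2
    have hNm : (0 : ℤ) < (N : ℤ) ^ m := by positivity
    have h3 : (N : ℤ) ^ m * |C j k| ≤ (N : ℤ) ^ m * (2 ^ m * N) := by
      calc (N : ℤ) ^ m * |C j k| ≤ (N : ℤ) * (2 * (N : ℤ)) ^ m := h2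
        _ = (N : ℤ) ^ m * (2 ^ m * N) := by rw [mul_pow]; ring
    have h4 := le_of_mul_le_mul_left h3 hNm
    simpa using h4

/-- **Entries of `C` on a LOWER-TRIANGULAR reduced basis** (the shape letter `k < j → U k j = 0` of the r2 frame): `U·C = N·1`,
`|det C| = N`, `0 ≤ Uᵢⱼ ≤ N`, `U a b = 0` for `a < b` ⇒ `|C j k| ≤ 2^{n−1}·N` (transpose of the upper case).
[cite: Cassels1997, Ch. I §2.2 Thm I; shape only] -/
theorem abs_le_two_pow_of_mul_eq_smul_one_lower {n : ℕ} {N : ℕ} (hN : 0 < N) (C U : Matrix (Fin n) (Fin n) ℤ)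
    (hUC : U * C = (N : ℤ) • (1 : Matrix (Fin n) (Fin n) ℤ)) (hdet : |C.det| = N)
    (hbox : ∀ i j, 0 ≤ U i j ∧ U i j ≤ N) (htri : ∀ a b : Fin n, (a : ℕ) < b → U a b = 0) (j k : Fin n) :
    |C j k| ≤ 2 ^ (n - 1) * (N : ℤ) := by
  have hCU' : C.transpose * U.transpose = (N : ℤ) • (1 : Matrix (Fin n) (Fin n) ℤ) := by
    rw [← Matrix.transpose_mul, hUC, Matrix.transpose_smul, Matrix.transpose_one]
  have hdet' : |C.transpose.det| = N := by rw [Matrix.det_transpose]; exact hdet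
  have h := abs_le_two_pow_of_mul_eq_smul_one_upper hN C.transpose U.transpose hCU' hdet'
    (fun i j => hbox j i) (fun a b hab => htri b a hab) k j
  simpa [Matrix.transpose_apply] using h

/-- The same, in the `natAbs` currency of the START datum (`F.C.det.natAbs = F.N`). [folklore] -/
theorem abs_le_two_pow_of_mul_eq_smul_one_lower' {n : ℕ} {N : ℕ} (hN : 0 < N) (C U : Matrix (Fin n) (Fin n) ℤ)
    (hUC : U * C = (N : ℤ) • (1 : Matrix (Fin n) (Fin n) ℤ)) (hdet : C.det.natAbs = N)
    (hbox : ∀ i j, 0 ≤ U i j ∧ U i j ≤ N) (htri : ∀ a b : Fin n, a < b → U a b = 0) (j k : Fin n) :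
    |C j k| ≤ 2 ^ (n - 1) * (N : ℤ) := by
  refine abs_le_two_pow_of_mul_eq_smul_one_lower hN C U hUC ?_ hbox (fun a b hab => htri a b hab) j k
  rw [Int.abs_eq_natAbs, hdet]

end SatBasisReduced

end Summit.ABC.StewartYu
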